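import Summits.Ventures.Crystal3D.Theorems.StickyWulffConstantNoReconstructionGainRimCount
import Summits.Ventures.Crystal3D.Theorems.StickyWulffConstantNoReconstructionGainLatticeAdhesion
import Summits.Ventures.Crystal3D.Theorems.StickyWulffConstantNoReconstructionGainWindowBarlowLocal
import HarnessLib

/-!
# From closure form to slab form: the rim of the `ν`-slab sample costs `O(ρ)`

HONEST FRAMING. Part of the venture `Summits/Ventures/Crystal3D` (cell `crystal3d-full`), helper
`--supports` the crux `NoReconstructionGain` (stmt-Ventures-19144, route
`route-Ventures-StickyWulffConstant`), line `adhesion`; continuation of `…RimCount`.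

The closure-form certificates (`…NTiltBarlowFilm`, `…OneOverhangFilm`, `…TwoOverhangFilm`) need, at
every substrate ball `p` touching the film, all `ν`-downward lattice neighbours `p + d` inside the
substrate.  In the slab sample `P = Λ₀ ∩ {−2R ≤ ⟪·,ν⟫ ≤ −R, lateral ≤ ρ}` with `R = 2` and the film
above the cut this can only fail when `p + d` pokes out LATERALLY, i.e. `p` lies in the band
`lateral ∈ (ρ − 1, ρ]`, `⟪p, ν⟫ ∈ (−3, −2]` — at most `64 ρ` substrate balls (`card_shellBand_le`,
two half-windows), hence at most `768 ρ` film balls touch a "bad" substrate ball.  Deleting those film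
balls `E` restores the closure hypothesis for the rest, and the bookkeeping
`#cross(P, F) ≤ #cross(P, F \ E) + 12 #E`, `D(F) ≥ D(F \ E) − 12 #E` gives:

* `slabForm_of_localClosure` — if the closure-form inequality `#cross(P, X' \ P) ≤ D(X' \ P)` holds
  for every intermediate configuration `P ⊆ X' ⊆ X` whose film-adjacent substrate balls are one-step
  closed, then `#cross(P, X \ P) ≤ D(X \ P) + 18432 ρ` for the slab sample (`R = 2`, film above the
  cut).

WHAT THIS IS NOT: a certificate; the regime rungs in slab form are the next file; F-C1 not moved.
-/

noncomputable section

namespace Summit.Ventures.Crystal3D.Theorems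

open Summit.Ventures.Crystal3D Finset Module
open Literature.MathematicalPhysics.StatisticalMechanics (barlowPos fccStacking barlowOffset layerNormal constHagg
  haggLabel_const barlowPos_mem barlowPos_apply_zero barlowPos_apply_one barlowPos_apply_two orderedContacts
  contactDeficiency)
open scoped InnerProductSpace

/-- The twelve bond vectors of the list are lattice vectors of norm at most `1`. -/
theorem l12_mem_norm {d : EuclideanSpace ℝ (Fin 3)}
    (hd : d ∈ ([barlowPos 1 (Real.sqrt (2 / 3)) constHagg 0 1 0, -barlowPos 1 (Real.sqrt (2 / 3)) constHagg 0 1 0,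
        barlowPos 1 (Real.sqrt (2 / 3)) constHagg 0 0 1, -barlowPos 1 (Real.sqrt (2 / 3)) constHagg 0 0 1,
        barlowPos 1 (Real.sqrt (2 / 3)) constHagg 0 1 (-1), -barlowPos 1 (Real.sqrt (2 / 3)) constHagg 0 1 (-1),
        barlowPos 1 (Real.sqrt (2 / 3)) constHagg 1 0 0, -barlowPos 1 (Real.sqrt (2 / 3)) constHagg 1 0 0,
        barlowPos 1 (Real.sqrt (2 / 3)) constHagg (-1) 1 0, -barlowPos 1 (Real.sqrt (2 / 3)) constHagg (-1) 1 0,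
        barlowPos 1 (Real.sqrt (2 / 3)) constHagg (-1) 0 1, -barlowPos 1 (Real.sqrt (2 / 3)) constHagg (-1) 0 1] :
        List (EuclideanSpace ℝ (Fin 3)))) :
    d ∈ fccStacking 1 (Real.sqrt (2 / 3)) ∧ ‖d‖ ^ 2 = 1 := by
  have h3 : Real.sqrt 3 ^ 2 = 3 := Real.sq_sqrt (by norm_num)
  have hh : Real.sqrt (2 / 3) ^ 2 = 2 / 3 := Real.sq_sqrt (by norm_num)
  have key : ∀ k i j : ℤ, ‖barlowPos 1 (Real.sqrt (2 / 3)) constHagg k i j‖ ^ 2 =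
      ((i : ℝ) + j / 2 + k / 2) ^ 2 + 3 / 4 * ((j : ℝ) + k / 3) ^ 2 + 2 / 3 * (k : ℝ) ^ 2 := by
    intro k i j
    rw [EuclideanSpace.real_norm_sq_eq, Fin.sum_univ_three]
    simp only [barlowPos_apply_zero, barlowPos_apply_one, barlowPos_apply_two,
      haggLabel_const, one_mul]
    linear_combination ((j : ℝ) + k / 3) ^ 2 / 4 * h3 + (k : ℝ) ^ 2 * hh
  simp only [List.mem_cons, List.mem_nil_iff, or_false] at hd
  rcases hd with rfl | rfl | rfl | rfl | rfl | rfl | rfl | rfl | rfl | rfl | rfl | rfl <;>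
    first
    | exact ⟨barlowPos_mem _ _ _, by rw [key]; push_cast; norm_num⟩
    | exact ⟨fcc_neg_mem (barlowPos_mem _ _ _), by rw [norm_neg, key]; push_cast; norm_num⟩

/-- **Closure form ⇒ slab form.**  `P` the `ν`-slab sample with `R = 2` and lateral radius `ρ ≥ 2`
inside a finite unit packing `X`, film above the cut.  If `#cross(P, X' \ P) ≤ D(X' \ P)` holds for
every `P ⊆ X' ⊆ X` whose film-adjacent substrate balls have all `ν`-downward lattice neighbours in
`P`, then `#cross(P, X \ P) ≤ D(X \ P) + 18432 ρ`. -/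
theorem slabForm_of_localClosure (ν : EuclideanSpace ℝ (Fin 3)) (hν : ‖ν‖ = 1) (ρ : ℝ) (hρ : 2 ≤ ρ)
    (X P : Finset (EuclideanSpace ℝ (Fin 3)))
    (hX : ∀ p ∈ X, ∀ q ∈ X, p ≠ q → 1 ≤ dist p q) (hPX : P ⊆ X)
    (hP : ∀ p, p ∈ P ↔ (p ∈ fccStacking 1 (Real.sqrt (2 / 3)) ∧ -(2 * 2) ≤ ⟪p, ν⟫_ℝ ∧
      ⟪p, ν⟫_ℝ ≤ -2 ∧ ‖p‖ ^ 2 - ⟪p, ν⟫_ℝ ^ 2 ≤ ρ ^ 2))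
    (habove : ∀ q ∈ X \ P, -2 < ⟪q, ν⟫_ℝ)
    (hLCF : ∀ X' : Finset (EuclideanSpace ℝ (Fin 3)), P ⊆ X' → X' ⊆ X →
      (∀ p ∈ P, ∀ q ∈ X' \ P, dist p q = 1 →
        ∀ d ∈ ([barlowPos 1 (Real.sqrt (2 / 3)) constHagg 0 1 0, -barlowPos 1 (Real.sqrt (2 / 3)) constHagg 0 1 0,
            barlowPos 1 (Real.sqrt (2 / 3)) constHagg 0 0 1, -barlowPos 1 (Real.sqrt (2 / 3)) constHagg 0 0 1,
            barlowPos 1 (Real.sqrt (2 / 3)) constHagg 0 1 (-1), -barlowPos 1 (Real.sqrt (2 / 3)) constHagg 0 1 (-1),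
            barlowPos 1 (Real.sqrt (2 / 3)) constHagg 1 0 0, -barlowPos 1 (Real.sqrt (2 / 3)) constHagg 1 0 0,
            barlowPos 1 (Real.sqrt (2 / 3)) constHagg (-1) 1 0, -barlowPos 1 (Real.sqrt (2 / 3)) constHagg (-1) 1 0,
            barlowPos 1 (Real.sqrt (2 / 3)) constHagg (-1) 0 1, -barlowPos 1 (Real.sqrt (2 / 3)) constHagg (-1) 0 1] :
            List (EuclideanSpace ℝ (Fin 3))),
          ⟪d, ν⟫_ℝ < 0 → p + d ∈ P) →
      ((((P ×ˢ (X' \ P)).filter fun pq => dist pq.1 pq.2 = 1).card : ℕ) : ℝ) ≤ contactDeficiency (X' \ P)) :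
    ((((P ×ˢ (X \ P)).filter fun pq => dist pq.1 pq.2 = 1).card : ℕ) : ℝ) ≤
      contactDeficiency (X \ P) + 18432 * ρ := by
  classical
  set L12 : List (EuclideanSpace ℝ (Fin 3)) := [barlowPos 1 (Real.sqrt (2 / 3)) constHagg 0 1 0,
    -barlowPos 1 (Real.sqrt (2 / 3)) constHagg 0 1 0,
    barlowPos 1 (Real.sqrt (2 / 3)) constHagg 0 0 1, -barlowPos 1 (Real.sqrt (2 / 3)) constHagg 0 0 1,
    barlowPos 1 (Real.sqrt (2 / 3)) constHagg 0 1 (-1), -barlowPos 1 (Real.sqrt (2 / 3)) constHagg 0 1 (-1),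
    barlowPos 1 (Real.sqrt (2 / 3)) constHagg 1 0 0, -barlowPos 1 (Real.sqrt (2 / 3)) constHagg 1 0 0,
    barlowPos 1 (Real.sqrt (2 / 3)) constHagg (-1) 1 0, -barlowPos 1 (Real.sqrt (2 / 3)) constHagg (-1) 1 0,
    barlowPos 1 (Real.sqrt (2 / 3)) constHagg (-1) 0 1, -barlowPos 1 (Real.sqrt (2 / 3)) constHagg (-1) 0 1]
    with hL12
  -- bad substrate balls and the rim film set
  set bad : EuclideanSpace ℝ (Fin 3) → Prop := fun p => ∃ d ∈ L12, ⟪d, ν⟫_ℝ < 0 ∧ p + d ∉ P with hbad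
  set Pbad := P.filter fun p => (∃ q ∈ X \ P, dist p q = 1) ∧ bad p with hPbad
  set E := (X \ P).filter fun q => ∃ p ∈ P, dist p q = 1 ∧ bad p with hE
  set F := X \ P with hF
  have hEF : E ⊆ F := filter_subset _ _
  set X' := X \ E with hX'
  have hPX' : P ⊆ X' := by
    intro p hp
    rw [hX', mem_sdiff]
    exact ⟨hPX hp, fun h => (mem_sdiff.1 (hEF h)).2 hp⟩
  have hX'X : X' ⊆ X := sdiff_subset
  have hF' : X' \ P = F \ E := by
    ext x; simp only [hX', hF, mem_sdiff]; tauto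
  -- the closure hypothesis holds off `E`
  have hclos' : ∀ p ∈ P, ∀ q ∈ X' \ P, dist p q = 1 → ∀ d ∈ L12, ⟪d, ν⟫_ℝ < 0 → p + d ∈ P := by
    intro p hp q hq hd d hdL hdν
    rw [hF'] at hq
    obtain ⟨hqF, hqE⟩ := mem_sdiff.1 hq
    by_contra hnot
    exact hqE (mem_filter.2 ⟨hqF, p, hp, hd, d, hdL, hdν, hnot⟩)
  have h1 := hLCF X' hPX' hX'X hclos'
  rw [hF'] at h1
  -- partner counts
  have h12 : ∀ z : EuclideanSpace ℝ (Fin 3), ∀ S : Finset (EuclideanSpace ℝ (Fin 3)), S ⊆ X →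
      ((S.filter fun x => dist z x = 1).card : ℝ) ≤ 12 := by
    intro z S hS
    have := card_partners_le_twelve X hX z
    have hsub : (S.filter fun x => dist z x = 1) ⊆ X.filter fun x => dist z x = 1 :=
      filter_subset_filter _ hS
    exact_mod_cast (card_le_card hsub).trans this
  -- (a) cross(P, F) = cross(P, F \ E) + cross(P, E) ≤ cross(P, F \ E) + 12 #E
  have hsplitF : F = (F \ E) ∪ E := (sdiff_union_of_subset hEF).symm
  have hcrossE : ((((P ×ˢ E).filter fun pq => dist pq.1 pq.2 = 1).card : ℕ) : ℝ) ≤ 12 * E.card := by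
    rw [card_cross_eq_sum_card_plug_partners]
    have := sum_le_sum fun q (_ : q ∈ E) => h12 q P hPX
    simpa [sum_const, nsmul_eq_mul, mul_comm] using this
  have hcross : ((((P ×ˢ F).filter fun pq => dist pq.1 pq.2 = 1).card : ℕ) : ℝ) ≤
      (((P ×ˢ (F \ E)).filter fun pq => dist pq.1 pq.2 = 1).card : ℕ) + 12 * E.card := by
    have hu : (P ×ˢ F).filter (fun pq => dist pq.1 pq.2 = 1) =
        (P ×ˢ (F \ E)).filter (fun pq => dist pq.1 pq.2 = 1) ∪ (P ×ˢ E).filter (fun pq => dist pq.1 pq.2 = 1) := by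
      rw [← filter_union, ← product_union, ← hsplitF]
    have hle := card_union_le ((P ×ˢ (F \ E)).filter (fun pq => dist pq.1 pq.2 = 1))
      ((P ×ˢ E).filter (fun pq => dist pq.1 pq.2 = 1))
    rw [← hu] at hle
    have : ((((P ×ˢ F).filter fun pq => dist pq.1 pq.2 = 1).card : ℕ) : ℝ) ≤
        (((P ×ˢ (F \ E)).filter fun pq => dist pq.1 pq.2 = 1).card : ℕ) +
        ((((P ×ˢ E).filter fun pq => dist pq.1 pq.2 = 1).card : ℕ) : ℝ) := by exact_mod_cast hle
    linarith
  -- (b) D(F) ≥ D(F \ E) − 12 #E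
  have hDsplit := contactDeficiency_sdiff_split (X := F) (P := E) hEF
  have hDE : 0 ≤ contactDeficiency E := by
    have hdef : contactDeficiency E = 6 * (E.card : ℝ) - (orderedContacts E : ℝ) / 2 := rfl
    have hoc : (orderedContacts E : ℝ) ≤ 12 * E.card := by
      rw [orderedContacts_eq_sum_card_partners]
      have := sum_le_sum fun q (_ : q ∈ E) => h12 q E (hEF.trans sdiff_subset)
      simpa [sum_const, nsmul_eq_mul, mul_comm] using this
    rw [hdef]; linarith
  have hcrossEF : ((((E ×ˢ (F \ E)).filter fun pq => dist pq.1 pq.2 = 1).card : ℕ) : ℝ) ≤ 12 * E.card := by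
    rw [card_crossContacts_eq_sum_sum]
    have : ∀ e ∈ E, (∑ q ∈ F \ E, if dist e q = 1 then (1 : ℝ) else 0) ≤ 12 := by
      intro e he
      rw [← sum_filter]; simp only [sum_const, nsmul_eq_mul, mul_one]
      exact h12 e (F \ E) (sdiff_subset.trans sdiff_subset)
    have := sum_le_sum this
    simpa [sum_const, nsmul_eq_mul, mul_comm] using this
  -- (c) #E ≤ 12 #Pbad
  have hEcard : (E.card : ℝ) ≤ 12 * Pbad.card := by
    have hsub : E ⊆ Pbad.biUnion fun p => X.filter fun x => dist p x = 1 := by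
      intro q hq
      obtain ⟨hqF, p, hp, hd, hb⟩ := mem_filter.1 hq
      exact mem_biUnion.2 ⟨p, mem_filter.2 ⟨hp, ⟨q, hqF, hd⟩, hb⟩, mem_filter.2 ⟨(mem_sdiff.1 hqF).1, hd⟩⟩
    have h := (card_le_card hsub).trans card_biUnion_le
    have h' : (∑ p ∈ Pbad, (X.filter fun x => dist p x = 1).card : ℝ) ≤ ∑ p ∈ Pbad, (12 : ℝ) :=
      sum_le_sum fun p _ => h12 p X (Subset.refl _)
    rw [sum_const, nsmul_eq_mul] at h'
    have : (E.card : ℝ) ≤ ∑ p ∈ Pbad, ((X.filter fun x => dist p x = 1).card : ℝ) := by exact_mod_cast h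
    linarith
  -- (d) #Pbad ≤ 64 ρ: bad substrate balls lie in the rim band
  have hband : ∀ p ∈ Pbad, (ρ - 1) ^ 2 ≤ ‖p‖ ^ 2 - ⟪p, ν⟫_ℝ ^ 2 ∧ ‖p‖ ^ 2 - ⟪p, ν⟫_ℝ ^ 2 ≤ ρ ^ 2 ∧
      -3 < ⟪p, ν⟫_ℝ ∧ ⟪p, ν⟫_ℝ ≤ -2 := by
    intro p hp
    obtain ⟨hpP, ⟨q, hq, hdq⟩, d, hdL, hdν, hnd⟩ := mem_filter.1 hp
    obtain ⟨hpΛ, _, hpt, hplat⟩ := (hP p).1 hpP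
    obtain ⟨hdΛ, hdn⟩ := l12_mem_norm hdL
    -- heights
    have hpq : |⟪p - q, ν⟫_ℝ| ≤ 1 := by
      have h := abs_real_inner_le_norm (p - q) ν
      rw [hν, mul_one, ← dist_eq_norm, hdq] at h; exact h
    have hpt' : -3 < ⟪p, ν⟫_ℝ := by
      have := habove q hq
      rw [inner_sub_left] at hpq
      have := (abs_le.1 hpq).1; linarith
    have hdν1 : -1 ≤ ⟪d, ν⟫_ℝ := by
      have h := abs_real_inner_le_norm d ν
      rw [hν, mul_one] at h
      have hdn' : ‖d‖ ≤ 1 := by nlinarith [norm_nonneg d]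
      have := (abs_le.1 h).1; linarith
    -- `p + d` is a lattice point in the slab's height range, so it is outside laterally
    have hlat : ρ ^ 2 < ‖p + d‖ ^ 2 - ⟪p + d, ν⟫_ℝ ^ 2 := by
      by_contra hle
      push Not at hle
      refine hnd ((hP (p + d)).2 ⟨fcc_add_site_mem hpΛ hdΛ, ?_, ?_, hle⟩)
      · rw [inner_add_left]; linarith
      · rw [inner_add_left]; linarith
    -- lateral triangle inequality via the projection onto `(ℝ ∙ ν)ᗮ`
    have hnorm : ∀ x : EuclideanSpace ℝ (Fin 3),
        ‖((ℝ ∙ ν)ᗮ).orthogonalProjectionOnto x‖ ^ 2 = ‖x‖ ^ 2 - ⟪x, ν⟫_ℝ ^ 2 := by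
      intro x
      have e1 := Submodule.norm_sq_eq_add_norm_sq_projection x (ℝ ∙ ν)
      have e2' : ‖((ℝ ∙ ν).orthogonalProjectionOnto x : EuclideanSpace ℝ (Fin 3))‖ = |⟪x, ν⟫_ℝ| := by
        rw [Submodule.coe_orthogonalProjectionOnto_apply, Submodule.starProjection_singleton ℝ, norm_smul, hν,
          real_inner_comm]
        simp
      have e2 : ‖(ℝ ∙ ν).orthogonalProjectionOnto x‖ = |⟪x, ν⟫_ℝ| := by rw [← e2', Submodule.coe_norm]
      rw [e2, sq_abs] at e1
      linarith
    have htri : ‖((ℝ ∙ ν)ᗮ).orthogonalProjectionOnto (p + d)‖ ≤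
        ‖((ℝ ∙ ν)ᗮ).orthogonalProjectionOnto p‖ + ‖((ℝ ∙ ν)ᗮ).orthogonalProjectionOnto d‖ := by
      rw [map_add]; exact norm_add_le _ _
    have hyd : ‖((ℝ ∙ ν)ᗮ).orthogonalProjectionOnto d‖ ≤ 1 := by
      have := hnorm d
      nlinarith [norm_nonneg (((ℝ ∙ ν)ᗮ).orthogonalProjectionOnto d), sq_nonneg ⟪d, ν⟫_ℝ]
    have hypd : ρ < ‖((ℝ ∙ ν)ᗮ).orthogonalProjectionOnto (p + d)‖ := by
      have := hnorm (p + d)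
      nlinarith [norm_nonneg (((ℝ ∙ ν)ᗮ).orthogonalProjectionOnto (p + d))]
    have hyp : ρ - 1 ≤ ‖((ℝ ∙ ν)ᗮ).orthogonalProjectionOnto p‖ := by linarith
    have hyp2 := hnorm p
    refine ⟨?_, hplat, hpt', hpt⟩
    nlinarith
  have hPbadcard : (Pbad.card : ℝ) ≤ 64 * ρ := by
    set P1 := Pbad.filter fun p => ⟪p, ν⟫_ℝ ≤ -(5 / 2) with hP1
    set P2 := Pbad.filter fun p => ¬ ⟪p, ν⟫_ℝ ≤ -(5 / 2) with hP2
    have hsplit : Pbad.card = P1.card + P2.card := by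
      rw [hP1, hP2, card_filter_add_card_filter_not]
    have hsep : ∀ S : Finset (EuclideanSpace ℝ (Fin 3)), S ⊆ Pbad → ∀ p ∈ S, ∀ q ∈ S, p ≠ q → 1 ≤ dist p q :=
      fun S hS p hp q hq hpq => hX p (hPX (mem_filter.1 (hS hp)).1) q (hPX (mem_filter.1 (hS hq)).1) hpq
    have h1' := card_shellBand_le ν hν P1 (hsep P1 (filter_subset _ _)) ρ 1 (-3) (by norm_num) (by linarith)
      (fun x hx => by
        obtain ⟨hxB, hxt⟩ := mem_filter.1 hx
        obtain ⟨a1, a2, a3, a4⟩ := hband x hxB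
        exact ⟨a1, a2, by linarith, by linarith⟩)
    have h2' := card_shellBand_le ν hν P2 (hsep P2 (filter_subset _ _)) ρ 1 (-(5 / 2)) (by norm_num) (by linarith)
      (fun x hx => by
        obtain ⟨hxB, hxt⟩ := mem_filter.1 hx
        obtain ⟨a1, a2, a3, a4⟩ := hband x hxB
        exact ⟨a1, a2, by linarith, by linarith⟩)
    have : (Pbad.card : ℝ) = P1.card + P2.card := by exact_mod_cast hsplit
    linarith
  -- assemble
  have hEρ : (E.card : ℝ) ≤ 768 * ρ := by linarith
  rw [hF] at *
  linarith [hDsplit, hDE, hcrossEF, hcross, h1, hEρ]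

end Summit.Ventures.Crystal3D.Theorems

end
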